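import Literature.NumberTheory.ModularSymbols.CuspidalHomologyShiftSubOneFibre
import HarnessLib

/-!
# Route `TameQuarticManinParity`, LINE 28b (bsd-idea-3 g8): `PS_of` — an eigenform whose mod-`3` eigen-system is
# saturated on `V₁(𝔽₃)` is period-saturated (route-independent helper for O22 = stmt-BirchSwinnertonDyer-28139)

Seat `bsd-line-tqmp-g28-p1` g1 (prover; director-bsd (280)(b), critic idea-crit-5 VERDICT #167 PASS-WITH-PRICE /
NOTE #170), landing the `PS_of` half of the planner-of-record's scratch `O22_of_MS.lean` (bsd-idea-3 HOME
`ideas/l28/`, sha16 `46dc5b029d3b456f`) against the tree. THEOREMS ONLY (no definition, no named fact, no `sorry`;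
axioms `propext`, `Classical.choice`, `Quot.sound`); NO `Theses` import (this file sits outside every route cone; the
by-name glue O22 ⇐ MS lives in `TameQuarticManinParityTwistLatticeOrientationOfModThreeSaturation`). Nothing here is
specific to elliptic curves: it is modular-symbol algebra at a level `N` with `9 ∣ N`. No summit is proved; BSD is
NOT proved by this file; O22 (stmt-28139) stays open.

## Content

Notation: `9 ∣ N`, `t = [1, 1/3; 0, 1]` the level-`3` shift (`shiftDual = t_*` on `S₂(Γ₀(N))^∨`, `shiftInt` on
`Λ = H₁(X₀(N), ℤ) = periodHomologyHecke N`), `Λ₁ = (t − 1)Λ = shiftSubOneLattice N h9` with its operators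
`shiftOne` (`t`) and `heckeOne` (`T_p`, `p ≠ 3`), `V₁(R) = R ⊗ Λ₁ = ShiftSubOneModule N h9 R` with `shiftOneR`,
`heckeOneR`, `genIsotypicOne` (tree `CuspidalHomologyShiftNorm`, `CuspidalHomologyShiftSubOneFibre`), and
`ev_f = periodMap N f : Λ → ℂ` (tree `CuspidalHomologyHeckeModule`).

* `periodSaturation_iff_forall_mem_shiftSubOneLattice` — PERIOD SATURATION `PS(f)` (hypothesis 6 of G28 =
  stmt-BirchSwinnertonDyer-23285, verbatim: every value `((t_* − 1)φ)(f)`, `φ ∈ H₁`, is a value `((t_* − 1)²ψ)(f)`)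
  in carrier language: `PS(f) ⟺ ev_f(Λ₁) ⊆ ev_f((t − 1)Λ₁)`.
* `shiftSubOneLattice_submodule_eq_top_of_modThreeSaturation` — the MOD-3 STEP, for an abstract sublattice
  `G ≤ Λ₁`: if `G ⊇ (t − 1)Λ₁`, every `T_p` (`p ∈ S`) is an integer scalar `a_p` modulo `G`, and the joint generalised
  eigenspace `V₁(𝔽₃)[ā^∞]` lies in `(1 − t̄)V₁(𝔽₃)`, then `G = Λ₁`. PROOF. `G ⊇ 3Λ₁` (`(1 − t)² = −3t` on `Λ₁`, tree
  `three_smul_mem_of_range_le`). Reduce mod `3` along the fibre map `Λ₁ → V₁(𝔽₃)` (`toFibre`): `W := span Ḡ ≤ V₁(𝔽₃)`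
  is a submodule modulo which every `T̄_p` is the scalar `ā_p` and `t̄` is `1` (`sub_smul_mem_span_image_of_forall`),
  so `W ⊇ (1 − t̄)V₁ ⊇ V₁[ā^∞]`; by Fitting's lemma for the commuting family `(T̄_p)_{p ∈ S}` on the finite module
  `V₁(𝔽₃)` (tree `eq_top_of_genIsotypicOne_le`, over `CommutingFamily.map_biInf_maxGenEigenspace_eq_top`)
  `W = V₁(𝔽₃)`; pulling back (`mem_of_toFibre_mem_span_image`, `G ⊇ 3Λ₁`) gives `G = Λ₁`.
* `psOfShape_proof` — **`PS_of`** (memo LINE23 §13.10 (iii); the typed shape `PSOfShape` of `PS_of_plan.lean` with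
  its two `Prop` abbreviations `ModThreeSaturation` / `PeriodSaturation` unfolded, so that no definition is buried in
  this proof file): if `fs ∈ S₂(Γ₀(N))` is an eigenform of the `T_p`, `p ∈ S` (finite), `p ≠ 3`, with integer
  eigenvalues `a_p`, and `V₁(𝔽₃)[ā^∞] ⊆ (1 − t̄)V₁(𝔽₃)` (MOD-3 SATURATION), then `PS(fs)` — apply the mod-3 step to
  `G = {x ∈ Λ₁ | ev x ∈ ev((t − 1)Λ₁)}` (`T_p ≡ a_p (mod G)` by `periodMap_smul_of_eigen`).
-/

set_option autoImplicit false
-- D-0017: single-problem summit, so `Summit.BirchSwinnertonDyer.BirchSwinnertonDyer.…` repeats a namespace BY DESIGN.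
set_option linter.dupNamespace false

noncomputable section

open scoped MatrixGroups TensorProduct

open CongruenceSubgroup

namespace Summit.BirchSwinnertonDyer.BirchSwinnertonDyer.Theorems.TameQuarticManinParity

open Literature.NumberTheory.EllipticCurves Literature.NumberTheory.EllipticCurves.ModularForms
  Literature.NumberTheory.ModularSymbols

section PeriodSaturation

variable {N : ℕ} [NeZero N] (h9 : 3 ^ 2 ∣ N)

/-- **Period saturation in carrier language.** For `f ∈ S₂(Γ₀(N))`, `9 ∣ N`: every value
`((t_* − 1)φ)(f)` (`φ ∈ H₁ = periodHomology N`) is a value `((t_* − 1)²ψ)(f)` (`ψ ∈ H₁`) — hypothesis 6 of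
G28 = stmt-BirchSwinnertonDyer-23285 verbatim — iff `ev_f(Λ₁) ⊆ ev_f((t − 1)Λ₁)` for the lattice
`Λ₁ = (t − 1)H₁ = shiftSubOneLattice N h9` and the period map `ev_f = periodMap N f`
(the value `((t_* − 1)²ψ)(f)` is `ev_f((t − 1)y)` with `y = t_*ψ − ψ ∈ Λ₁`). [cite: Manin1972, Prop. 1.4] -/
theorem periodSaturation_iff_forall_mem_shiftSubOneLattice (f : CuspForm (Gamma0 N) 2) :
    (∀ φ ∈ periodHomology N, ∃ ψ ∈ periodHomology N,
        (shiftDual N h9 φ - φ) f = (shiftDual N h9 (shiftDual N h9 ψ) - 2 • shiftDual N h9 ψ + ψ) f) ↔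
      ∀ x ∈ shiftSubOneLattice N h9, ∃ y ∈ shiftSubOneLattice N h9,
        periodMap N f x = periodMap N f (shiftInt N h9 y - y) := by
  constructor
  · intro h x hx
    obtain ⟨x', rfl⟩ := (mem_shiftSubOneLattice_iff N h9 x).mp hx
    obtain ⟨ψ, hψ, e⟩ := h (x' : Module.Dual ℂ (CuspForm (Gamma0 N) 2)) x'.2
    refine ⟨shiftInt N h9 ⟨ψ, hψ⟩ - ⟨ψ, hψ⟩, (mem_shiftSubOneLattice_iff N h9 _).mpr ⟨⟨ψ, hψ⟩, rfl⟩, ?_⟩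
    simp only [periodMap_apply, map_sub, coe_shiftInt, LinearMap.sub_apply] at e ⊢
    rw [e]
    simp only [shiftDual_apply, LinearMap.sub_apply, LinearMap.smul_apply, LinearMap.add_apply]
    ring
  · intro h φ hφ
    obtain ⟨y, hy, e⟩ := h (shiftInt N h9 ⟨φ, hφ⟩ - ⟨φ, hφ⟩)
      ((mem_shiftSubOneLattice_iff N h9 _).mpr ⟨⟨φ, hφ⟩, rfl⟩)
    obtain ⟨y', rfl⟩ := (mem_shiftSubOneLattice_iff N h9 y).mp hy
    refine ⟨(y' : Module.Dual ℂ (CuspForm (Gamma0 N) 2)), y'.2, ?_⟩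
    simp only [periodMap_apply, map_sub, coe_shiftInt] at e
    rw [LinearMap.sub_apply, e]
    simp only [shiftDual_apply, LinearMap.sub_apply, LinearMap.smul_apply, LinearMap.add_apply]
    ring

/-- **The mod-`3` step of `PS_of`**: a sublattice `G ≤ Λ₁ = (t − 1)H₁(X₀(N), ℤ)` containing `(t − 1)Λ₁` and
modulo which every `T_p`, `p ∈ S` (finite, `p ≠ 3` prime), is an integer scalar `a_p` (`T_p x − a_p x ∈ G`) is ALL
of `Λ₁`, provided MOD-`3` SATURATION holds: the joint generalised eigenspace `V₁(𝔽₃)[ā^∞]` of the `T̄_p − ā_p` on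
`V₁(𝔽₃) = 𝔽₃ ⊗ Λ₁` lies in `(1 − t̄)V₁(𝔽₃)`. Proof: `G ⊇ 3Λ₁` (`(1 − t)² = −3t` on `Λ₁`, tree
`three_smul_mem_of_range_le`); the reduction `W = span Ḡ ≤ V₁(𝔽₃)` of `G` along the fibre map `Λ₁ → V₁(𝔽₃)` is a
submodule modulo which `t̄ ≡ 1` and `T̄_p ≡ ā_p` (tree `sub_smul_mem_span_image_of_forall`), so
`W ⊇ (1 − t̄)V₁ ⊇ V₁[ā^∞]` and Fitting's lemma for the commuting family `(T̄_p)_{p ∈ S}` on the finite module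
`V₁(𝔽₃)` gives `W = V₁(𝔽₃)` (tree `eq_top_of_genIsotypicOne_le`); pull back along the fibre map, whose kernel is
`3Λ₁ ⊆ G` (tree `mem_of_toFibre_mem_span_image`).
[cite: Jacobson1989BasicAlgebraII, §3.4 Fitting's lemma (38), p. 113 (derived reading via the tree's `CommutingFamily.map_biInf_maxGenEigenspace_eq_top` / `eq_top_of_genIsotypicOne_le`)] -/
theorem shiftSubOneLattice_submodule_eq_top_of_modThreeSaturation (G : Submodule ℤ (shiftSubOneLattice N h9))
    (hG1 : LinearMap.range (shiftOne N h9 - 1) ≤ G) (S : Finset ℕ) (a : ℕ → ℤ)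
    (hGT : ∀ (p : ℕ) (hp : p.Prime) (hp3 : p ≠ 3), p ∈ S →
      ∀ x : shiftSubOneLattice N h9, heckeOne h9 hp hp3 x - a p • x ∈ G)
    (hsat : genIsotypicOne N h9 (ZMod 3) (↑S : Set ℕ) (fun p ↦ (a p : ZMod 3)) ≤
      LinearMap.range (1 - shiftOneR N h9 (ZMod 3))) :
    G = ⊤ := by
  -- `3Λ₁ ⊆ G`
  have hG3 : ∀ y : shiftSubOneLattice N h9, ((3 : ℕ) : ℤ) • y ∈ G := three_smul_mem_of_range_le N h9 hG1
  -- `t ≡ 1 (mod G)` on `Λ₁`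
  have hGt : ∀ x : shiftSubOneLattice N h9, shiftOne N h9 x - (1 : ℤ) • x ∈ G := by
    intro x
    rw [one_smul]
    exact hG1 (LinearMap.mem_range_self (shiftOne N h9 - 1) x)
  -- modulo `W = span Ḡ`, `T̄_p ≡ ā_p` and `t̄ ≡ 1`
  have hWT : ∀ (p : ℕ) (hp : p.Prime) (hp3 : p ≠ 3), p ∈ S → ∀ v : ShiftSubOneModule N h9 (ZMod 3),
      heckeOneR h9 hp hp3 v - (a p : ZMod 3) • v ∈
        Submodule.span (ZMod 3) (toFibre N h9 (ZMod 3) '' (G : Set (shiftSubOneLattice N h9))) :=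
    fun p hp hp3 hpS v ↦
      sub_smul_mem_span_image_of_forall N h9 (ZMod 3) G (heckeOne h9 hp hp3) (heckeOneR h9 hp hp3 (R := ZMod 3))
        (fun x ↦ (toFibre_heckeOne h9 (R := ZMod 3) hp hp3 x).symm) (a p) (hGT p hp hp3 hpS) v
  have hWt : LinearMap.range (1 - shiftOneR N h9 (ZMod 3)) ≤
      Submodule.span (ZMod 3) (toFibre N h9 (ZMod 3) '' (G : Set (shiftSubOneLattice N h9))) := by
    rintro _ ⟨v, rfl⟩
    have h := sub_smul_mem_span_image_of_forall N h9 (ZMod 3) G (shiftOne N h9) (shiftOneR N h9 (ZMod 3))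
      (fun x ↦ (toFibre_shiftOne N h9 (ZMod 3) x).symm) 1 hGt v
    rw [Int.cast_one, one_smul] at h
    have e : (1 - shiftOneR N h9 (ZMod 3)) v = -(shiftOneR N h9 (ZMod 3) v - v) := by
      rw [LinearMap.sub_apply, Module.End.one_apply, neg_sub]
    rw [e]
    exact Submodule.neg_mem _ h
  -- Fitting: `W = V₁(𝔽₃)`
  have hWtop : Submodule.span (ZMod 3) (toFibre N h9 (ZMod 3) '' (G : Set (shiftSubOneLattice N h9))) = ⊤ :=
    eq_top_of_genIsotypicOne_le N h9 (ZMod 3) S (fun p ↦ (a p : ZMod 3)) _ hWT (hsat.trans hWt)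
  -- pull back along the fibre map (kernel `3Λ₁ ⊆ G`)
  rw [eq_top_iff]
  rintro x -
  refine mem_of_toFibre_mem_span_image N h9 3 hG3 ?_
  rw [hWtop]
  exact Submodule.mem_top

/-- **`PS_of`** (bsd-idea-3 memo LINE23 §13.10 (iii); the typed shape `PSOfShape` of `PS_of_plan.lean` with its
abbreviations `ModThreeSaturation` / `PeriodSaturation` unfolded). Let `9 ∣ N`, `fs ∈ S₂(Γ₀(N))` an eigenform of
the Hecke operators `T_p`, `p ∈ S` (a finite set), `p ≠ 3` prime, with integer eigenvalues `a_p`, and suppose MOD-`3`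
SATURATION: on `V₁(𝔽₃) = 𝔽₃ ⊗ Λ₁`, `Λ₁ = (t − 1)H₁(X₀(N), ℤ)`, the joint generalised eigenspace of the `T̄_p − ā_p`
(`p ∈ S`) lies in `(1 − t̄)V₁(𝔽₃)`. Then `fs` is PERIOD-SATURATED: every value `((t_* − 1)φ)(fs)`, `φ ∈ H₁`, is a
value `((t_* − 1)²ψ)(fs)`, `ψ ∈ H₁`. Proof: apply `shiftSubOneLattice_submodule_eq_top_of_modThreeSaturation` to the
sublattice `G = {x ∈ Λ₁ | ev_{fs} x ∈ ev_{fs}((t − 1)Λ₁)}`, which contains `(t − 1)Λ₁` trivially and every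
`T_p x − a_p x` because `ev_{fs}` is Hecke-equivariant for the eigencharacter (`periodMap_smul_of_eigen`:
`ev((T_p − a_p)x) = 0`); `G = Λ₁` is period saturation in carrier language
(`periodSaturation_iff_forall_mem_shiftSubOneLattice`).
[cite: Jacobson1989BasicAlgebraII, §3.4 Fitting's lemma (38), p. 113 (derived reading, see `shiftSubOneLattice_submodule_eq_top_of_modThreeSaturation`)] [cite: CremonaAlgorithms1997, §2.10] -/
theorem psOfShape_proof (N : ℕ) [NeZero N] (h9 : 3 ^ 2 ∣ N) (fs : CuspForm (Gamma0 N) 2) (S : Finset ℕ)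
    (a : ℕ → ℤ)
    (heig : ∀ (p : ℕ) (hp : p.Prime), p ≠ 3 → p ∈ S →
      HeckeRing0.toEnd N 2 (HeckeRing0.T N 2 p hp) fs = (a p : ℂ) • fs)
    (hsat : genIsotypicOne N h9 (ZMod 3) (↑S : Set ℕ) (fun p ↦ (a p : ZMod 3)) ≤
      LinearMap.range (1 - shiftOneR N h9 (ZMod 3))) :
    ∀ φ ∈ periodHomology N, ∃ ψ ∈ periodHomology N,
      (shiftDual N h9 φ - φ) fs = (shiftDual N h9 (shiftDual N h9 ψ) - 2 • shiftDual N h9 ψ + ψ) fs := by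
  rw [periodSaturation_iff_forall_mem_shiftSubOneLattice]
  -- the good sublattice `G = {x ∈ Λ₁ | ev x ∈ ev((t − 1)Λ₁)}`, through its membership predicate only
  obtain ⟨G, hmemG⟩ : ∃ G : Submodule ℤ (shiftSubOneLattice N h9), ∀ x : shiftSubOneLattice N h9,
      x ∈ G ↔ ∃ y : shiftSubOneLattice N h9,
        periodMap N fs (shiftInt N h9 y - y) = periodMap N fs (x : periodHomologyHecke N) := by
    refine ⟨Submodule.comap (periodMap N fs ∘ₗ (shiftSubOneLattice N h9).subtype)
      (LinearMap.range (periodMap N fs ∘ₗ (shiftSubOneLattice N h9).subtype ∘ₗ (shiftOne N h9 - 1))),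
      fun x ↦ ?_⟩
    simp only [Submodule.mem_comap, LinearMap.mem_range, LinearMap.coe_comp, Function.comp_apply,
      Submodule.coe_subtype, LinearMap.sub_apply, Module.End.one_apply, Submodule.coe_sub, coe_shiftOne]
  -- `(t − 1)Λ₁ ⊆ G`
  have hG1 : LinearMap.range (shiftOne N h9 - 1) ≤ G := by
    rintro _ ⟨y, rfl⟩
    refine (hmemG _).mpr ⟨y, ?_⟩
    rw [LinearMap.sub_apply, Module.End.one_apply, Submodule.coe_sub, coe_shiftOne]
  -- `T_p ≡ a_p (mod G)` on `Λ₁` for `p ∈ S` (witness `y = 0`)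
  have hGT : ∀ (p : ℕ) (hp : p.Prime) (hp3 : p ≠ 3), p ∈ S →
      ∀ x : shiftSubOneLattice N h9, heckeOne h9 hp hp3 x - a p • x ∈ G := by
    intro p hp hp3 hpS x
    refine (hmemG _).mpr ⟨0, ?_⟩
    rw [Submodule.coe_zero, map_zero, sub_zero, map_zero, Submodule.coe_sub, Submodule.coe_smul, coe_heckeOne,
      map_sub, map_zsmul, periodMap_smul_of_eigen (N := N) (heig p hp hp3 hpS), zsmul_eq_mul, sub_self]
  -- the mod-3 step: `G = Λ₁`
  have hGtop := shiftSubOneLattice_submodule_eq_top_of_modThreeSaturation h9 G hG1 S a hGT hsat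
  intro x hx
  obtain ⟨y, hy⟩ := (hmemG ⟨x, hx⟩).mp (hGtop ▸ Submodule.mem_top)
  exact ⟨y, y.2, hy.symm⟩

end PeriodSaturation

end Summit.BirchSwinnertonDyer.BirchSwinnertonDyer.Theorems.TameQuarticManinParity

end
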